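import Summits.BirchSwinnertonDyer.BirchSwinnertonDyer.Theses.ShadowIsolation
import Summits.BirchSwinnertonDyer.BirchSwinnertonDyer.Theorems.ShadowIsolationPrimeSupplyIrreducible

/-!
# BirchSwinnertonDyer / ShadowIsolation — crux `PhantomShadow` (stmt-BirchSwinnertonDyer-15787):
# negative lemmas (standing disprover, cycle 1) — the Ш-trigger is load-bearing, `1 ≤ n` is not

Load-bearing analysis of
`PhantomShadow := ∀ W [W.IsElliptic] [W.IsGloballyMinimal] p [Fact p.Prime], 5 ≤ p → good p → ordinary p →
  irreducible E[p] → ∀ n, 1 ≤ n → (∃ σ : W.sha, addOrderOf σ = p ^ n) → A(W,p,n)`,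
where `A(W,p,n)` (an even-sign newform `g ≠ f_W` on `Γ₀(N_W·M)`, `M` squarefree coprime to `p·N_W`, strongly
depth-`n` congruent to `W`, with `Λ(g,1) = 0`) is VERBATIM the predicate negated in the sibling crux
`IsolationOfAccidentalZeros`, as kernel-checked theorems. No route statement is asserted positively and no
definition is introduced (statements are inlined; the instantiating curve is the literal `⟨0, 0, 0, -1, 0⟩`).

* `phantomShadow_false_without_trigger_of_isolation` — the TRIGGER `∃ σ : W.sha, addOrderOf σ = p ^ n` is
  load-bearing: `A(W,p,n)` never mentions `σ`, and the trigger-free statement ("shadows at every depth for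
  every qualifying `(W,p)`") CONTRADICTS `IsolationOfAccidentalZeros` — instantiate both at a global minimal
  model of `y² = x³ - x` (`hasGlobalMinimalModel_rat_holds`) and at the prime of the PROVED support item
  `PrimeSupplyIrreducible` (`primeSupplyIrreducible_proof`), at depth `max n₀ 1`. So a σ-free proof strategy for
  the crux (deep level raising supplies strongly congruent even newforms at every depth — Camporino–Pacetti 2018
  — "then pick one with a central zero") would refute the route's other crux: any proof must route through `σ`.
* `phantomShadow_without_pos_iff` — the side condition `1 ≤ n` is NOT load-bearing for falsity: dropping it adds
  exactly the σ-free depth-0 demand (trigger witnessed by `σ = 0`, and at `n = 0` the congruence clause is vacuous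
  because `ZMod (p ^ 0)` is the zero ring) that every qualifying `(W,p)` has SOME even-sign newform `g ≠ f_W` at
  some squarefree coprime level with `Λ(g,1) = 0` — a plausible existence statement, not a refutable one.
Full adversarial record (statement audit, why the crux itself is unfalsifiable here — no Ш-witness with
irreducible `E[p]`, `p ≥ 5`, is constructible and `¬A` is infinite in `M` — strong-vs-weak congruence models):
`Cruxes/PhantomShadow/Disproof.lean`. [folklore]
-/

set_option linter.dupNamespace false

namespace Summit.BirchSwinnertonDyer.BirchSwinnertonDyer.Theorems

open Summit.BirchSwinnertonDyer.BirchSwinnertonDyer.Theses.ShadowIsolation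
open Literature.NumberTheory.EllipticCurves.ModularForms

/-- **The Ш-trigger of `PhantomShadow` is load-bearing** (modulo the sibling crux): with
`(∃ σ : W.sha, addOrderOf σ = p ^ n) →` deleted, the statement is refuted by `IsolationOfAccidentalZeros`,
at a global minimal model of `y² = x³ - x` and a good ordinary `p ≥ 5` with irreducible `E[p]`
(`primeSupplyIrreducible_proof`), depth `max n₀ 1`. [folklore] -/
theorem phantomShadow_false_without_trigger_of_isolation (hI : IsolationOfAccidentalZeros) :
    ¬ ∀ (W : WeierstrassCurve ℚ) [W.IsElliptic] [W.IsGloballyMinimal] (p : ℕ) [Fact p.Prime], 5 ≤ p →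
      W.HasGoodReductionAtPrime p → ¬ (p : ℤ) ∣ W.frobeniusTrace p → W.HasIrreducibleModPGaloisRep p →
      ∀ n : ℕ, 1 ≤ n →
      ∃ (M : ℕ) (_ : NeZero (W.conductorNorm ℤ * M))
        (g : CuspForm (CongruenceSubgroup.Gamma0 (W.conductorNorm ℤ * M)) 2) (R : Subring ℂ)
        (φ : R →+* ZMod (p ^ n))
        (hR : ∀ ℓ : ℕ, ℓ.Prime → ¬ ℓ ∣ W.conductorNorm ℤ * M → heckeEigenvalue g ℓ ∈ R),
        Squarefree M ∧ Nat.Coprime M (p * W.conductorNorm ℤ) ∧ IsNewform0 g ∧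
        (∃ m : ℕ, (UpperHalfPlane.qExpansion 1 ⇑g).coeff m ≠ ((W.LFunction m : ℤ) : ℂ)) ∧
        cuspHeckeOperatorₗ (CongruenceSubgroup.Gamma0 (W.conductorNorm ℤ * M)) 2
          (slToGLPos ModularGroup.S * diagGL ((W.conductorNorm ℤ * M : ℕ) : ℚ) 1
            (Nat.cast_pos.mpr (NeZero.pos (W.conductorNorm ℤ * M))) one_pos) g = -g ∧
        (∀ (ℓ : ℕ) (hℓ : ℓ.Prime) (hℓL : ¬ ℓ ∣ W.conductorNorm ℤ * M),
          φ ⟨heckeEigenvalue g ℓ, hR ℓ hℓ hℓL⟩ = ((W.frobeniusTrace ℓ : ℤ) : ZMod (p ^ n))) ∧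
        ∃ Λ : ℂ → ℂ, Differentiable ℂ Λ ∧
          (∀ s : ℂ, 2 < s.re → Λ s = LSeries (fun m ↦ (UpperHalfPlane.qExpansion 1 ⇑g).coeff m) s) ∧
          Λ 1 = 0 := by
  intro hS
  haveI hE : (⟨0, 0, 0, -1, 0⟩ : WeierstrassCurve ℚ).IsElliptic := by
    rw [WeierstrassCurve.isElliptic_iff]
    simp only [WeierstrassCurve.Δ, WeierstrassCurve.b₂, WeierstrassCurve.b₄, WeierstrassCurve.b₆,
      WeierstrassCurve.b₈]
    norm_num
  obtain ⟨C, hC⟩ := WeierstrassCurve.hasGlobalMinimalModel_rat_holds (⟨0, 0, 0, -1, 0⟩ : WeierstrassCurve ℚ)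
  obtain ⟨p, hp, h5, hgood, hord, hirr⟩ := primeSupplyIrreducible_proof (C • (⟨0, 0, 0, -1, 0⟩ : WeierstrassCurve ℚ))
  obtain ⟨n₀, hn₀⟩ := hI (C • (⟨0, 0, 0, -1, 0⟩ : WeierstrassCurve ℚ)) p h5 hgood hord hirr
  exact hn₀ (max n₀ 1) (le_max_left _ _)
    (hS (C • (⟨0, 0, 0, -1, 0⟩ : WeierstrassCurve ℚ)) p h5 hgood hord hirr (max n₀ 1) (le_max_right _ _))

/-- **`1 ≤ n` is not load-bearing for falsity.** `PhantomShadow` with `1 ≤ n →` deleted is equivalent to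
`PhantomShadow` together with the σ-free, congruence-free depth-0 demand: every qualifying `(W, p)` has an
even-sign newform `g ≠ f_W` at some squarefree coprime level `N_W·M` with `Λ(g,1) = 0` (the trigger at
`n = 0` is `σ = 0`, `addOrderOf 0 = 1 = p ^ 0`; a ring map into the zero ring `ZMod 1` always exists and every
congruence in it holds). [folklore] -/
theorem phantomShadow_without_pos_iff :
    (∀ (W : WeierstrassCurve ℚ) [W.IsElliptic] [W.IsGloballyMinimal] (p : ℕ) [Fact p.Prime], 5 ≤ p →
      W.HasGoodReductionAtPrime p → ¬ (p : ℤ) ∣ W.frobeniusTrace p → W.HasIrreducibleModPGaloisRep p →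
      ∀ n : ℕ, (∃ σ : W.sha, addOrderOf σ = p ^ n) →
      ∃ (M : ℕ) (_ : NeZero (W.conductorNorm ℤ * M))
        (g : CuspForm (CongruenceSubgroup.Gamma0 (W.conductorNorm ℤ * M)) 2) (R : Subring ℂ)
        (φ : R →+* ZMod (p ^ n))
        (hR : ∀ ℓ : ℕ, ℓ.Prime → ¬ ℓ ∣ W.conductorNorm ℤ * M → heckeEigenvalue g ℓ ∈ R),
        Squarefree M ∧ Nat.Coprime M (p * W.conductorNorm ℤ) ∧ IsNewform0 g ∧
        (∃ m : ℕ, (UpperHalfPlane.qExpansion 1 ⇑g).coeff m ≠ ((W.LFunction m : ℤ) : ℂ)) ∧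
        cuspHeckeOperatorₗ (CongruenceSubgroup.Gamma0 (W.conductorNorm ℤ * M)) 2
          (slToGLPos ModularGroup.S * diagGL ((W.conductorNorm ℤ * M : ℕ) : ℚ) 1
            (Nat.cast_pos.mpr (NeZero.pos (W.conductorNorm ℤ * M))) one_pos) g = -g ∧
        (∀ (ℓ : ℕ) (hℓ : ℓ.Prime) (hℓL : ¬ ℓ ∣ W.conductorNorm ℤ * M),
          φ ⟨heckeEigenvalue g ℓ, hR ℓ hℓ hℓL⟩ = ((W.frobeniusTrace ℓ : ℤ) : ZMod (p ^ n))) ∧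
        ∃ Λ : ℂ → ℂ, Differentiable ℂ Λ ∧
          (∀ s : ℂ, 2 < s.re → Λ s = LSeries (fun m ↦ (UpperHalfPlane.qExpansion 1 ⇑g).coeff m) s) ∧
          Λ 1 = 0) ↔
    PhantomShadow ∧
    ∀ (W : WeierstrassCurve ℚ) [W.IsElliptic] [W.IsGloballyMinimal] (p : ℕ) [Fact p.Prime], 5 ≤ p →
      W.HasGoodReductionAtPrime p → ¬ (p : ℤ) ∣ W.frobeniusTrace p → W.HasIrreducibleModPGaloisRep p →
      ∃ (M : ℕ) (_ : NeZero (W.conductorNorm ℤ * M))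
        (g : CuspForm (CongruenceSubgroup.Gamma0 (W.conductorNorm ℤ * M)) 2),
        Squarefree M ∧ Nat.Coprime M (p * W.conductorNorm ℤ) ∧ IsNewform0 g ∧
        (∃ m : ℕ, (UpperHalfPlane.qExpansion 1 ⇑g).coeff m ≠ ((W.LFunction m : ℤ) : ℂ)) ∧
        cuspHeckeOperatorₗ (CongruenceSubgroup.Gamma0 (W.conductorNorm ℤ * M)) 2
          (slToGLPos ModularGroup.S * diagGL ((W.conductorNorm ℤ * M : ℕ) : ℚ) 1
            (Nat.cast_pos.mpr (NeZero.pos (W.conductorNorm ℤ * M))) one_pos) g = -g ∧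
        ∃ Λ : ℂ → ℂ, Differentiable ℂ Λ ∧
          (∀ s : ℂ, 2 < s.re → Λ s = LSeries (fun m ↦ (UpperHalfPlane.qExpansion 1 ⇑g).coeff m) s) ∧
          Λ 1 = 0 := by
  -- a ring map into the zero ring `ZMod 1`
  have zmap : ∀ (R : Subring ℂ), ∃ _ : R →+* ZMod 1, True := fun R =>
    ⟨{ toFun := fun _ => 0, map_one' := Subsingleton.elim _ _, map_mul' := fun _ _ => Subsingleton.elim _ _,
       map_zero' := rfl, map_add' := fun _ _ => Subsingleton.elim _ _ }, trivial⟩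
  constructor
  · intro h
    refine ⟨fun W _ _ p _ h5 hg ho hi n _ hσ => h W p h5 hg ho hi n hσ, fun W _ _ p _ h5 hg ho hi => ?_⟩
    obtain ⟨M, hM, g, R, φ, hR, hsq, hcop, hnew, hmis, hw, -, hΛ⟩ :=
      h W p h5 hg ho hi 0 ⟨0, by simp⟩
    exact ⟨M, hM, g, hsq, hcop, hnew, hmis, hw, hΛ⟩
  · rintro ⟨hS, h0⟩ W _ _ p _ h5 hg ho hi n hσ
    rcases Nat.eq_zero_or_pos n with rfl | hn
    · obtain ⟨M, hM, g, hsq, hcop, hnew, hmis, hw, hΛ⟩ := h0 W p h5 hg ho hi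
      obtain ⟨ψ, -⟩ := zmap ⊤
      rw [pow_zero]
      refine ⟨M, hM, g, ⊤, ψ, fun _ _ _ => Subring.mem_top _, hsq, hcop, hnew, hmis, hw, ?_, hΛ⟩
      intro ℓ hℓ hℓL
      exact Subsingleton.elim _ _
    · exact hS W p h5 hg ho hi n hn hσ

end Summit.BirchSwinnertonDyer.BirchSwinnertonDyer.Theorems
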